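import Summits.Ventures.Crystal3D.Kissing125.GSearchStructure
import HarnessLib

/-!
# Soundness of trimming and the pair rule, κ-generic — part 1/2

HONEST FRAMING (cell pub-crystal3d, K-path at `h = 5/4`, V4 = κ as an explicit parameter): this is NOT a result printed
by Hales; it is his METHOD (arXiv:1209.6043, Theorem 3 + Lemmas 7–10, in the tree's form of a verified interval-arithmetic
growth search, `Literature/…/KissingSearch*.lean`) with the largest long-side cosine `κ` made an EXPLICIT PARAMETER
(`κ : Kappa`, carrying the two numeric facts the soundness proof uses: `-1/2 ≤ κ`, `κ < 1/4`).  Only the declarations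
whose statement depends on `κ` are declared here (namespace `…Kissing125.GSearch`, the tree's short names, no renames);
every κ-free helper is the landed K25 copy (`…Kissing125.KissingSearch.*`) and every κ-free lemma is cited from the tree
(PRIVATE per-file citation aliases; `GSearchTransport.lean` holds `toT : St → tree St` and the transport equalities).  The K25
instance is `κ25 = ⟨7/32, …⟩`; `GSearchBridge.lean` identifies the generic checker at
`κ25` with the landed `Kissing125.KissingSearch.checkPart`, so the landed run files are consumed unchanged.  Generated by
`HOME/lean/kissing125/v4-prep/gen/mkgen.py`; nothing here is asserted about GAP(1.26) or any census.

THIS FILE: the κ-tainted declarations of `Literature/Geometry/DiscreteGeometry/KissingSearchRules.lean` (part 1 of 2), with `κ : Kappa` threaded; κ-free declarations of that file are NOT re-declared publicly (the κ-free helpers are the landed K25 copies; the κ-free tree lemmas used by the proofs are cited through PRIVATE aliases at the top of the file).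

## References
* T. C. Hales, *A proof of Fejes Tóth's conjecture on sphere packings with kissing number twelve*,
  arXiv:1209.6043 (2012): Definition 1, Theorem 2, Theorem 3, Lemmas 7–10. [`Hales2012`]
* R. E. Moore, *Interval Analysis* (1966), Theorem 3.1, §4.4. [`Moore1966`]
-/

namespace Summit.Ventures.Crystal3D.Kissing125

open Literature.Geometry.DiscreteGeometry
open Summit.Ventures.Crystal3D.Kissing125.KissingSearch

namespace GSearch

open Real Literature.Analysis.ValidatedNumerics KissingLP NonemptyInterval Finset

variable {κ : Kappa}

/-! ### κ-free tree lemmas used below, read over the K25 copies (PRIVATE citation aliases; the public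
surface of this file is κ-generic only) -/

/-- K25 reading of the tree lemma `firstOk_spec` (κ-free; proof = citation of the tree lemma). [folklore] -/
private theorem firstOk_spec (ok : ℕ → Bool) (n lo c : ℕ) :
  lo ≤ c → c < lo + n → ok c = true → ∃ lo', firstOk ok lo n = some lo' ∧ lo ≤ lo' ∧ lo' ≤ c ∧ ok lo' = true :=
  by rw [firstOk_tr]; exact Literature.Geometry.DiscreteGeometry.KissingSearch.firstOk_spec ok n lo c

/-- K25 reading of the tree lemma `gdom_sdom_of_ne` (κ-free; proof = citation of the tree lemma). [folklore] -/
private theorem gdom_sdom_of_ne {s : St} {a b r p q : ℕ}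
  (hne : sIdx p q ≠ sIdx a b) : (s.sdom a b r).gdom p q = s.gdom p q :=
  Literature.Geometry.DiscreteGeometry.KissingSearch.gdom_sdom_of_ne (s := toT s) hne

/-- K25 reading of the tree lemma `gdom_sdom_self` (κ-free; proof = citation of the tree lemma). [folklore] -/
private theorem gdom_sdom_self {s : St} {a b r : ℕ} (h : sIdx a b < s.dom.size) :
  (s.sdom a b r).gdom a b = r :=
  Literature.Geometry.DiscreteGeometry.KissingSearch.gdom_sdom_self (s := toT s) h

/-- K25 reading of the tree lemma `gsc_sdom` (κ-free; proof = citation of the tree lemma). [folklore] -/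
@[simp] private theorem gsc_sdom {s : St} (a b r p q : ℕ) :
  (s.sdom a b r).gsc p q = s.gsc p q :=
  Literature.Geometry.DiscreteGeometry.KissingSearch.gsc_sdom (s := toT s) a b r p q

/-- K25 reading of the tree lemma `lastOk_spec` (κ-free; proof = citation of the tree lemma). [folklore] -/
private theorem lastOk_spec (ok : ℕ → Bool) (n hi c : ℕ) :
  c ≤ hi → hi < c + n → ok c = true → ∃ hi', lastOk ok hi n = some hi' ∧ c ≤ hi' ∧ hi' ≤ hi ∧ ok hi' = true :=
  by rw [lastOk_tr]; exact Literature.Geometry.DiscreteGeometry.KissingSearch.lastOk_spec ok n hi c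

/-- K25 reading of the tree lemma `le_K_of_mem_symsList` (κ-free; proof = citation of the tree lemma). [folklore] -/
private theorem le_K_of_mem_symsList {r σ : ℕ} (hr : ValidDom r)
  (hσ : σ ∈ symsList r) : σ ≤ K :=
  Literature.Geometry.DiscreteGeometry.KissingSearch.le_K_of_mem_symsList hr hσ

/-- K25 reading of the tree lemma `lt_NS_of_mem_symsList` (κ-free; proof = citation of the tree lemma). [folklore] -/
private theorem lt_NS_of_mem_symsList {r σ : ℕ} (hr : ValidDom r)
  (hσ : σ ∈ symsList r) : σ < NS :=
  Literature.Geometry.DiscreteGeometry.KissingSearch.lt_NS_of_mem_symsList hr hσ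

/-- K25 reading of the tree lemma `lt_of_mem_tset` (κ-free; proof = citation of the tree lemma). [folklore] -/
private theorem lt_of_mem_tset {t v : ℕ} (ht : TriValid t) (hv : v ∈ tset t) : v < 12 :=
  Literature.Geometry.DiscreteGeometry.KissingSearch.lt_of_mem_tset ht hv

/-- K25 reading of the tree lemma `mem_trisAt` (κ-free; proof = citation of the tree lemma). [folklore] -/
private theorem mem_trisAt {s : St} {v t : ℕ} :
  t ∈ s.trisAt v ↔ t ∈ s.tris.toList ∧ tmem t v = true :=
  Literature.Geometry.DiscreteGeometry.KissingSearch.mem_trisAt (s := toT s)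

/-- K25 reading of the tree lemma `nat_le_of_mul_delta_le` (κ-free; proof = citation of the tree lemma). [folklore] -/
private theorem nat_le_of_mul_delta_le {m n : ℕ}
  (h : (↑m : ℝ) * (↑δ : ℝ) ≤ (↑n : ℝ) * (↑δ : ℝ)) : m ≤ n :=
  Literature.Geometry.DiscreteGeometry.KissingSearch.nat_le_of_mul_delta_le h

/-- K25 reading of the tree lemma `others_spec` (κ-free; proof = citation of the tree lemma). [folklore] -/
private theorem others_spec {t v : ℕ} (ht : TriValid t) (hv : v ∈ tset t) :
  v ≠ (others t v).1 ∧
    v ≠ (others t v).2 ∧ (others t v).1 ≠ (others t v).2 ∧ tset t = {v, (others t v).1, (others t v).2} :=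
  Literature.Geometry.DiscreteGeometry.KissingSearch.others_spec ht hv

/-- K25 reading of the tree lemma `pi_lt_NLAD_mul` (κ-free; proof = citation of the tree lemma). [folklore] -/
private theorem pi_lt_NLAD_mul : π < (↑NLAD : ℝ) * (↑δ : ℝ) :=
  Literature.Geometry.DiscreteGeometry.KissingSearch.pi_lt_NLAD_mul

/-- K25 reading of the tree lemma `sIdx_eq_iff` (κ-free; proof = citation of the tree lemma). [folklore] -/
private theorem sIdx_eq_iff {a b a' b' : ℕ} (ha : a < 12) (hb : b < 12)
  (ha' : a' < 12) (hb' : b' < 12) : sIdx a b = sIdx a' b' ↔ a = a' ∧ b = b' ∨ a = b' ∧ b = a' :=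
  Literature.Geometry.DiscreteGeometry.KissingSearch.sIdx_eq_iff ha hb ha' hb'

/-- K25 reading of the tree lemma `sIdx_lt` (κ-free; proof = citation of the tree lemma). [folklore] -/
private theorem sIdx_lt {a b : ℕ} (ha : a < 12) (hb : b < 12) : sIdx a b < 144 :=
  Literature.Geometry.DiscreteGeometry.KissingSearch.sIdx_lt ha hb

/-- K25 reading of the tree lemma `size_dom_sdom` (κ-free; proof = citation of the tree lemma). [folklore] -/
@[simp] private theorem size_dom_sdom {s : St} (a b r : ℕ) :
  (s.sdom a b r).dom.size = s.dom.size :=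
  Literature.Geometry.DiscreteGeometry.KissingSearch.size_dom_sdom (s := toT s) a b r

/-- K25 reading of the tree lemma `symsList_mkR_self` (κ-free; proof = citation of the tree lemma). [folklore] -/
private theorem symsList_mkR_self {c : ℕ} (h1 : 1 ≤ c) (hK : c ≤ K) :
  symsList (mkR c c) = [c] :=
  Literature.Geometry.DiscreteGeometry.KissingSearch.symsList_mkR_self h1 hK

/-- K25 reading of the tree lemma `tris_sdom` (κ-free; proof = citation of the tree lemma). [folklore] -/
@[simp] private theorem tris_sdom {s : St} (a b r : ℕ) : (s.sdom a b r).tris = s.tris :=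
  Literature.Geometry.DiscreteGeometry.KissingSearch.tris_sdom (s := toT s) a b r

/-- K25 reading of the tree lemma `validDom_mkR` (κ-free; proof = citation of the tree lemma). [folklore] -/
private theorem validDom_mkR {lo hi : ℕ} (h1 : 1 ≤ lo) (h2 : lo ≤ hi) (h3 : hi ≤ K) :
  ValidDom (mkR lo hi) :=
  Literature.Geometry.DiscreteGeometry.KissingSearch.validDom_mkR h1 h2 h3

/-- K25 reading of the tree lemma `sc_sdom` (κ-free; proof = citation of the tree lemma). [folklore] -/
@[simp] private theorem sc_sdom {s : St} (a b r : ℕ) : (s.sdom a b r).sc = s.sc :=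
  Literature.Geometry.DiscreteGeometry.KissingSearch.sc_sdom (s := toT s) a b r


/-! ### Part A. Writing a truthful code keeps a state realized -/

/-- **Writing a truthful code on a labelled side keeps the state realized.** [folklore] -/
theorem Realizes.sdom {M : KConf κ} {s : St} (hR : Realizes M s) {a b r : ℕ} (ha : a < 12)
    (hb : b < 12) (hab : a ≠ b) (hlab : s.gdom a b ≠ UNL) (hr : r ≠ UNL)
    (hsem : DomSem κ r (M.g a b)) : Realizes M (s.sdom a b r) where
  size_dom := by rw [size_dom_sdom]; exact hR.size_dom
  size_sc := hR.size_sc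
  valid := hR.valid
  mem := hR.mem
  nodup := hR.nodup
  sc_eq := fun p q hp hq hpq => by rw [gsc_sdom]; exact hR.sc_eq p q hp hq hpq
  dom := fun p q hp hq hpq => by
    by_cases hidx : sIdx p q = sIdx a b
    · have e : (s.sdom a b r).gdom p q = r := by
        unfold St.gdom; rw [hidx]; exact gdom_sdom_self (by rw [hR.size_dom]; exact sIdx_lt ha hb)
      rw [e]
      rcases (sIdx_eq_iff hp hq ha hb).1 hidx with ⟨rfl, rfl⟩ | ⟨rfl, rfl⟩
      · exact hsem
      · rw [M.g_symm]; exact hsem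
    · rw [gdom_sdom_of_ne hidx]; exact hR.dom p q hp hq hpq
  lab_side := fun p q hp hq hpq hl => by
    rw [tris_sdom]
    by_cases hidx : sIdx p q = sIdx a b
    · obtain ⟨t, ht, hat, hbt⟩ := hR.lab_side a b ha hb hab hlab
      rcases (sIdx_eq_iff hp hq ha hb).1 hidx with ⟨rfl, rfl⟩ | ⟨rfl, rfl⟩
      · exact ⟨t, ht, hat, hbt⟩
      · exact ⟨t, ht, hbt, hat⟩
    · rw [gdom_sdom_of_ne hidx] at hl
      exact hR.lab_side p q hp hq hpq hl
  side_lab := fun t ht p hp q hq hpq => by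
    by_cases hidx : sIdx p q = sIdx a b
    · unfold St.gdom; rw [hidx]
      rw [show (s.sdom a b r).dom.getD (sIdx a b) UNL = (s.sdom a b r).gdom a b from rfl,
        gdom_sdom_self (by rw [hR.size_dom]; exact sIdx_lt ha hb)]
      exact hr
    · rw [gdom_sdom_of_ne hidx]
      rw [tris_sdom] at ht
      exact hR.side_lab t ht p hp q hq hpq

/-- **The bracket over three valid domains holding the true symbols encloses the angle** of a
triangle of `M`. [cite: Moore1966, Theorem 3.1] -/
theorem encl_of_doms {M : KConf κ} {ra rb rc σa σb σc v a b : ℕ} {t : Finset ℕ} (hT : t ∈ M.T)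
    (hv : v ∈ t) (ha : a ∈ t) (hb : b ∈ t) (hva : v ≠ a) (hvb : v ≠ b) (hab : a ≠ b)
    (vda : ValidDom ra) (vdb : ValidDom rb) (vdc : ValidDom rc)
    (hσa : σa ∈ symsList ra) (hσb : σb ∈ symsList rb) (hσc : σc ∈ symsList rc)
    (hxa : SymMem κ σa (M.g v a)) (hxb : SymMem κ σb (M.g v b)) (hxc : SymMem κ σc (M.g a b)) :
    Encl (rangeBr κ ra rb rc) (M.ang t v) := by
  have hcos := M.cos_law _ hT v hv a ha b hb hva hvb hab
  have hP := M.circum _ hT v hv a ha b hb hva hvb hab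
  have hx1 := sq_lt_one_of_symMem (le_K_of_mem_symsList vda hσa) hxa
  have hy1 := sq_lt_one_of_symMem (le_K_of_mem_symsList vdb hσb) hxb
  have hbasic := basic_sound hxa hxb hxc hx1 hy1 hP (M.ang_nonneg _ _) (M.ang_le_pi _ _) hcos
  rw [← btab_eq (lt_NS_of_mem_symsList vda hσa) (lt_NS_of_mem_symsList vdb hσb)
    (lt_NS_of_mem_symsList vdc hσc)] at hbasic
  exact rangeBr_sound vda vdb vdc hσa hσb (rangeC_sound hσc hbasic)

/-! ### Part B. Trimming a side -/

/-- **Soundness of `trimSide`.**  If the window `[wlo δ, whi δ]` contains the true angle of the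
placed slot `(t, v)`, trimming one of its sides never kills and keeps the state realized.
[cite: Moore1966, §4.4] -/
theorem trimSide_sound {M : KConf κ} {s : St} (hR : Realizes M s) {t : ℕ} (ht : t ∈ s.tris.toList)
    {v : ℕ} (hv : v ∈ tset t) (role wlo whi : ℕ)
    (hw : (wlo : ℝ) * (δ : ℝ) ≤ M.ang (tset t) v ∧ M.ang (tset t) v ≤ (whi : ℝ) * (δ : ℝ)) :
    St.trimSide κ s t v role wlo whi ≠ none ∧
      ∀ s', St.trimSide κ s t v role wlo whi = some s' → Realizes M s' ∧ s'.tris = s.tris ∧ s'.sc = s.sc := by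
  have hval := hR.valid t ht
  obtain ⟨hva, hvb, hab, hset⟩ := others_spec hval hv
  set a := (others t v).1 with ha_def
  set b := (others t v).2 with hb_def
  have hT : tset t ∈ M.T := hR.mem t ht
  have hv12 : v < 12 := lt_of_mem_tset hval hv
  have haT : a ∈ tset t := by rw [hset]; simp
  have hbT : b ∈ tset t := by rw [hset]; simp
  have ha12 : a < 12 := lt_of_mem_tset hval haT
  have hb12 : b < 12 := lt_of_mem_tset hval hbT
  have lva := hR.side_lab t ht v hv a haT hva
  have lvb := hR.side_lab t ht v hv b hbT hvb
  have lab := hR.side_lab t ht a haT b hbT hab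
  have dva := hR.dom v a hv12 ha12 hva
  have dvb := hR.dom v b hv12 hb12 hvb
  have dab := hR.dom a b ha12 hb12 hab
  obtain ⟨vda, σa, hσa, hxa⟩ := exists_symMem_of_domSem dva lva
  obtain ⟨vdb, σb, hσb, hxb⟩ := exists_symMem_of_domSem dvb lvb
  obtain ⟨vdc, σc, hσc, hxc⟩ := exists_symMem_of_domSem dab lab
  -- the code, side and true value selected by `role`
  set ra := s.gdom v a with hra
  set rb := s.gdom v b with hrb
  set rc := s.gdom a b with hrc
  set r := (if role = 0 then ra else if role = 1 then rb else rc) with hr_def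
  -- the admissibility test
  set ok : ℕ → Bool := fun c =>
    let rr := mkR c c
    let br := if role = 0 then rangeBr κ rr rb rc else if role = 1 then rangeBr κ ra rr rc else rangeBr κ ra rb rr
    br != NOBR && brLo br ≤ whi && wlo ≤ brHi br with hok
  -- the true cell of the selected side passes the test
  have okc : ∀ {c : ℕ}, 1 ≤ c → c ≤ K →
      (role = 0 → SymMem κ c (M.g v a)) → (role ≠ 0 → role = 1 → SymMem κ c (M.g v b)) →
      (role ≠ 0 → role ≠ 1 → SymMem κ c (M.g a b)) → ok c = true := by
    intro c h1 hK h0 h1' h2'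
    have vdcc : ValidDom (mkR c c) := validDom_mkR h1 le_rfl hK
    have hcc : c ∈ symsList (mkR c c) := by rw [symsList_mkR_self h1 hK]; simp
    have hE : Encl (if role = 0 then rangeBr κ (mkR c c) rb rc else if role = 1 then rangeBr κ ra (mkR c c) rc
        else rangeBr κ ra rb (mkR c c)) (M.ang (tset t) v) := by
      by_cases r0 : role = 0
      · rw [if_pos r0]
        exact encl_of_doms hT hv haT hbT hva hvb hab vdcc vdb vdc hcc hσb hσc (h0 r0) hxb hxc
      · by_cases r1 : role = 1
        · rw [if_neg r0, if_pos r1]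
          exact encl_of_doms hT hv haT hbT hva hvb hab vda vdcc vdc hσa hcc hσc hxa (h1' r0 r1) hxc
        · rw [if_neg r0, if_neg r1]
          exact encl_of_doms hT hv haT hbT hva hvb hab vda vdb vdcc hσa hσb hcc hxa hxb (h2' r0 r1)
    obtain ⟨hne, hlo, hhi⟩ := hE
    have e1 : brLo (if role = 0 then rangeBr κ (mkR c c) rb rc else if role = 1 then rangeBr κ ra (mkR c c) rc
        else rangeBr κ ra rb (mkR c c)) ≤ whi := nat_le_of_mul_delta_le (hlo.trans hw.2)
    have e2 : wlo ≤ brHi (if role = 0 then rangeBr κ (mkR c c) rb rc else if role = 1 then rangeBr κ ra (mkR c c) rc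
        else rangeBr κ ra rb (mkR c c)) := nat_le_of_mul_delta_le (hw.1.trans hhi)
    simp only [hok, Bool.and_eq_true, bne_iff_ne, ne_eq, decide_eq_true_eq]
    exact ⟨⟨hne, e1⟩, e2⟩
  unfold St.trimSide
  simp only
  rw [← ha_def, ← hb_def]
  simp only [← hra, ← hrb, ← hrc]
  by_cases htriv : r = 0 ∨ r = UNL
  · rw [← hr_def, if_pos htriv]; exact ⟨Option.some_ne_none _, fun s' h => by cases h; exact ⟨hR, rfl, rfl⟩⟩
  · rw [← hr_def, if_neg htriv]
    rw [not_or] at htriv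
    -- the selected side: its code is a valid range, its value lies in a cell of the range
    have sel : ∃ x : ℝ, DomSem κ r x ∧ (role = 0 → x = M.g v a) ∧ (role ≠ 0 → role = 1 → x = M.g v b) ∧
        (role ≠ 0 → role ≠ 1 → x = M.g a b) := by
      by_cases r0 : role = 0
      · exact ⟨M.g v a, by rw [hr_def, if_pos r0]; exact dva, fun _ => rfl, fun h => absurd r0 h, fun h => absurd r0 h⟩
      · by_cases r1 : role = 1
        · exact ⟨M.g v b, by rw [hr_def, if_neg r0, if_pos r1]; exact dvb, fun h => absurd h r0, fun _ _ => rfl,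
            fun _ h => absurd r1 h⟩
        · exact ⟨M.g a b, by rw [hr_def, if_neg r0, if_neg r1]; exact dab, fun h => absurd h r0,
            fun _ h => absurd h r1, fun _ _ => rfl⟩
    obtain ⟨x, hxsem, hx0, hx1, hx2⟩ := sel
    rcases hxsem with h | ⟨h, -⟩ | ⟨vd, -, hxne, hxlo, hxhi⟩
    · exact absurd h htriv.2
    · exact absurd h htriv.1
    rcases vd with h | ⟨hl1, hl2, hl3, hl4⟩
    · exact absurd h htriv.1
    obtain ⟨c, hc1, hc2, hcx⟩ := exists_cell (rHi r - rLo r) (rLo r) (rHi r) (by omega) hl1 hxlo hxhi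
    have hokc : ok c = true := okc (by omega) (by omega) (fun h => hx0 h ▸ hcx) (fun h h' => hx1 h h' ▸ hcx)
      (fun h h' => hx2 h h' ▸ hcx)
    obtain ⟨lo', e1, hlo1, hlo2, -⟩ := firstOk_spec ok (rHi r + 1 - rLo r) (rLo r) c hc1 (by omega) hokc
    rw [← hok, e1]
    simp only
    obtain ⟨hi', e2, hhi1, hhi2, -⟩ := lastOk_spec ok (rHi r + 1 - lo') (rHi r) c hc2 (by omega) hokc
    rw [e2]
    simp only
    -- the new code is truthful
    have vnew : ValidDom (mkR lo' hi') := validDom_mkR (by omega) (by omega) (by omega)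
    have elo : rLo (mkR lo' hi') = lo' := by unfold rLo mkR; have : K = 15 := rfl; omega
    have ehi : rHi (mkR lo' hi') = hi' := by unfold rHi mkR; have : K = 15 := rfl; omega
    have hne0 : mkR lo' hi' ≠ 0 := by unfold mkR; omega
    have hneU : mkR lo' hi' ≠ UNL := by unfold mkR UNL; have : K = 15 := rfl; omega
    have hcell := (symMem_cell_iff (by omega : c ≠ 0)).1 hcx
    have semx : DomSem κ (mkR lo' hi') x := by
      right; right
      refine ⟨vnew, hne0, hxne, ?_, ?_⟩
      · rw [elo]
        exact le_trans (by exact_mod_cast gridPt_mono (by omega : lo' - 1 ≤ c - 1)) hcell.1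
      · rw [ehi]
        exact le_trans hcell.2 (by exact_mod_cast gridPt_mono hhi1)
    refine ⟨by split_ifs <;> exact Option.some_ne_none _, fun s' hs' => ?_⟩
    split_ifs at hs' with hsame r0 r1
    · cases hs'; exact ⟨hR, rfl, rfl⟩
    · cases hs'; rw [hx0 r0] at semx; exact ⟨hR.sdom hv12 ha12 hva lva hneU semx, rfl, rfl⟩
    · cases hs'; rw [hx1 r0 r1] at semx; exact ⟨hR.sdom hv12 hb12 hvb lvb hneU semx, rfl, rfl⟩
    · cases hs'; rw [hx2 r0 r1] at semx; exact ⟨hR.sdom ha12 hb12 hab lab hneU semx, rfl, rfl⟩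

/-- A fold of `Option`-valued steps that never kill realized states and keep them realized (and
keep the triangles) ends realized. [folklore] -/
theorem fold_opt_sound {M : KConf κ} (L : List ℕ) (f : St → ℕ → Option St)
    (hf : ∀ s x, x ∈ L → Realizes M s → (f s x ≠ none ∧ ∀ s', f s x = some s' → Realizes M s' ∧ s'.tris = s.tris)) :
    ∀ (s : St), Realizes M s →
      (L.foldl (fun os x => match os with | none => none | some s => f s x) (some s)) ≠ none ∧
      ∀ s', L.foldl (fun os x => match os with | none => none | some s => f s x) (some s) = some s' →
        Realizes M s' ∧ s'.tris = s.tris := by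
  induction L with
  | nil => intro s hs; simp [hs]
  | cons x L ih =>
    intro s hs
    rw [List.foldl_cons]
    obtain ⟨h1, h2⟩ := hf s x (by simp) hs
    obtain ⟨s1, e1⟩ := Option.ne_none_iff_exists'.1 h1
    obtain ⟨hs1, ht1⟩ := h2 s1 e1
    simp only [e1]
    obtain ⟨i1, i2⟩ := ih (fun s' y hy hs' => hf s' y (by simp [hy]) hs') s1 hs1
    exact ⟨i1, fun s' hs' => let ⟨q1, q2⟩ := i2 s' hs'; ⟨q1, q2.trans ht1⟩⟩

/-- **Soundness of `trimTrisAt`** (feasibility trims, window `[0, NLAD δ] ⊇ [0, π]`). [folklore] -/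
theorem trimTrisAt_sound {M : KConf κ} {s : St} (hR : Realizes M s) (v : ℕ) :
    St.trimTrisAt κ s v ≠ none ∧ ∀ s', St.trimTrisAt κ s v = some s' → Realizes M s' ∧ s'.tris = s.tris := by
  unfold St.trimTrisAt
  -- one triangle: three trims at its vertex `tv0`
  have step : ∀ (s1 : St) (t : ℕ), t ∈ s.trisAt v → Realizes M s1 → s1.tris = s.tris →
      ((match St.trimSide κ s1 t (tv0 t) 0 0 NLAD with
        | none => none
        | some s2 => match St.trimSide κ s2 t (tv0 t) 1 0 NLAD with
          | none => none
          | some s3 => St.trimSide κ s3 t (tv0 t) 2 0 NLAD) ≠ none) ∧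
      ∀ s', (match St.trimSide κ s1 t (tv0 t) 0 0 NLAD with
        | none => none
        | some s2 => match St.trimSide κ s2 t (tv0 t) 1 0 NLAD with
          | none => none
          | some s3 => St.trimSide κ s3 t (tv0 t) 2 0 NLAD) = some s' → Realizes M s' ∧ s'.tris = s1.tris := by
    intro s1 t ht hs1 htr
    have ht1 : t ∈ s1.tris.toList := by rw [htr]; exact (mem_trisAt.1 ht).1
    have hv0 : tv0 t ∈ tset t := by unfold tset; simp
    have hw : ∀ s2 : St, ((0 : ℕ) : ℝ) * (δ : ℝ) ≤ M.ang (tset t) (tv0 t) ∧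
        M.ang (tset t) (tv0 t) ≤ ((NLAD : ℕ) : ℝ) * (δ : ℝ) := fun _ =>
      ⟨by simpa using M.ang_nonneg _ _, (M.ang_le_pi _ _).trans pi_lt_NLAD_mul.le⟩
    obtain ⟨n1, k1⟩ := trimSide_sound hs1 ht1 hv0 0 0 NLAD (hw s1)
    obtain ⟨s2, e2⟩ := Option.ne_none_iff_exists'.1 n1
    obtain ⟨hs2, t2, -⟩ := k1 s2 e2
    simp only [e2]
    obtain ⟨n2, k2⟩ := trimSide_sound hs2 (by rw [t2]; exact ht1) hv0 1 0 NLAD (hw s2)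
    obtain ⟨s3, e3⟩ := Option.ne_none_iff_exists'.1 n2
    obtain ⟨hs3, t3, -⟩ := k2 s3 e3
    simp only [e3]
    obtain ⟨n3, k3⟩ := trimSide_sound hs3 (by rw [t3, t2]; exact ht1) hv0 2 0 NLAD (hw s3)
    exact ⟨n3, fun s' e4 => ⟨(k3 s' e4).1, by rw [(k3 s' e4).2.1, t3, t2]⟩⟩
  -- fold
  have gen : ∀ (L : List ℕ), (∀ t ∈ L, t ∈ s.trisAt v) → ∀ (s1 : St), Realizes M s1 → s1.tris = s.tris →
      (L.foldl (fun os t => match os with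
        | none => none
        | some s => match St.trimSide κ s t (tv0 t) 0 0 NLAD with
          | none => none
          | some s => match St.trimSide κ s t (tv0 t) 1 0 NLAD with
            | none => none
            | some s => St.trimSide κ s t (tv0 t) 2 0 NLAD) (some s1)) ≠ none ∧
      ∀ s', (L.foldl (fun os t => match os with
        | none => none
        | some s => match St.trimSide κ s t (tv0 t) 0 0 NLAD with
          | none => none
          | some s => match St.trimSide κ s t (tv0 t) 1 0 NLAD with
            | none => none
            | some s => St.trimSide κ s t (tv0 t) 2 0 NLAD) (some s1)) = some s' → Realizes M s' ∧ s'.tris = s.tris := by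
    intro L
    induction L with
    | nil => intro _ s1 hs1 htr; simp [hs1, htr]
    | cons t L ih =>
      intro hL s1 hs1 htr
      rw [List.foldl_cons]
      obtain ⟨n1, k1⟩ := step s1 t (hL t (by simp)) hs1 htr
      obtain ⟨s2, e2⟩ := Option.ne_none_iff_exists'.1 n1
      obtain ⟨hs2, ht2⟩ := k1 s2 e2
      simp only [e2]
      exact ih (fun t' ht' => hL t' (by simp [ht'])) s2 hs2 (ht2.trans htr)
  exact gen _ (fun t ht => ht) s hR rfl

/-! ### Part C. The pairing rule -/

/-- The cells below `ZCELL` are entirely negative: `gridPt j < 0` for `j < 11`. [folklore] -/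
theorem gridPt_neg {j : ℕ} (hj : j < 11) : gridPt κ j < 0 := by
  have h10 : gridPt κ 10 < 0 := by
    have := κ.lt_quarter; unfold gridPt K; push_cast; nlinarith
  exact lt_of_le_of_lt (gridPt_mono (by omega)) h10


end GSearch

end Summit.Ventures.Crystal3D.Kissing125
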